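import Mathlib
import Summits.NavierStokesRegularity.NavierStokesRegularity.Theorems.DssFarFieldSlavingBlowupTypeIDssProfileGaussianSmallTypeICore
import Summits.NavierStokesRegularity.NavierStokesRegularity.Theorems.DssFarFieldSlavingBlowupTypeIDssProfileGaussianGapTypeI
import Summits.NavierStokesRegularity.NavierStokesRegularity.Theorems.DssFarFieldSlavingBlowupTypeIDssProfileSmoothRepresentativeAe
import Literature.Analysis.FluidPDE.VectorCalculusProofs
import HarnessLib

/-!
# Gaussian enstrophy under a small Type-I constant, file 4/4: the EXPLICIT, UNCONDITIONAL
  small-Type-I Liouville slice — classical and CLASS level (pub-ns-dss T38/T31 scope Row 3 =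
  «T31-G»; route `DssFarFieldSlaving`, crux `BlowupTypeIDssProfile`, stmt-NavierStokesRegularity-0155 —
  SUPPORT, LABEL-BEARING; typer seat g7, 2026-08-23; lead A215)

HONEST FRAMING. Exclusion statements about a HYPOTHETICAL object (a Type-I ancient mild solution /
a member of the rotated-DSS Type-I class): IF the Type-I constant `M` (`‖V(t,x)‖ ≤ M/√(−t)`, resp.
`‖u(t,x)‖ ≤ M/(‖x‖ + √(−t))` at class level) satisfies `4M² + (3√6/4)M < 1` — i.e.
`M < m₀ := (√(16 + 27/8) − 3√6/4)/8 ≈ 0.3206` — THEN the field vanishes. UNCONDITIONAL within the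
class: NO decay hypothesis (D), NO named input (D_M); the only analytic inputs are the tree's
class-uniform scale-invariant gauge bounds (`typeIGauge_exists_pow_mul_norm_iteratedFDeriv_le`, KNSS
2009 Prop. 4.1 + scaling) and the tree's similarity vorticity equation
(`IsTypeIAncientMild.lerayVorticity_eq`), exactly as for T41′ (`typeI_ancient_gaussianGap_eq_zero'`).
EXPLICIT: the constant is a closed-form algebraic number (what the crude Cauchy–Schwarz / Young
bookkeeping of file 3 gives; not optimised). It sits between the tree's INEXPLICIT absolute small
constant (`exists_typeIAncientMild_eq_zero_of_small`, `typeI_ancient_smallConstant_ae_zero`: `∃ ε₀`)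
and the cell's CONDITIONAL `M < 1` rows (T31″ given (D) = `typeI_ancient_eq_zero_of_typeI_lt_one`;
T31⁗ DERIVED). MECHANISM DSS-BLIND: the class proof discards `c`, `R`, `IsRotatedDSS`. Census words on
ACCEPT are the lead's (A215). Nothing numeric about any candidate; nothing here bears on Navier–Stokes
regularity or blow-up. Derivation: typer g7 (bus l.1579), a typer's remark in the sense of T41′.

CONTENTS. **`typeI_ancient_eq_zero_of_gaussianSmallTypeI`** (classical, KNSS gauge) and
**`rdssClass_empty_of_gaussianSmallTypeI`** (CLASS level, the conclusion shape of
`ExplicitThreshold.rdssClass_empty_of_timeOnlyThreshold`, with NO hypothesis `h`); rational forms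
`typeI_ancient_eq_zero_of_typeI_le` / `rdssClass_empty_of_typeI_le` (`M ≤ 8/25 = 0.32`). [this file]
-/

noncomputable section

set_option linter.dupNamespace false

namespace Summit.NavierStokesRegularity.NavierStokesRegularity.Theorems.GaussianGap

open Set Function Filter MeasureTheory InnerProductSpace Real Metric
open scoped RealInnerProductSpace Laplacian ContDiff Topology BigOperators
open Literature.Analysis Literature.Analysis.FluidPDE Literature.Analysis.UnboundedOperators
open Summit.NavierStokesRegularity.NavierStokesRegularity.Theorems
open Summit.NavierStokesRegularity.NavierStokesRegularity.Theorems.BlobRiccatiClosure.TypeIApexLiouville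

/-- **T31-G, CLASSICAL level: the explicit, unconditional small-Type-I Liouville slice.** Let `V`
be a Type-I ancient mild field in the KNSS gauge with Type-I constant `M` (`IsTypeIAncientMild M V`:
smooth on `t < 0`, divergence free, Oseen-mild, `‖V(t,x)‖ ≤ M/√(−t)`). If
`4M² + (3√6/4)·M < 1` (equivalently `M < m₀ ≈ 0.3206`), then `V ≡ 0` on `t < 0`. Proof: the
similarity vorticity `Ω` and profile `U` (`‖U‖ ≤ M`, `norm_lerayOrbit_le_of_typeI`) have class-uniform
bounds on `Ω, DΩ, D²Ω, U, DU` (KNSS Prop. 4.1 transported by scaling,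
`typeIGauge_exists_pow_mul_norm_iteratedFDeriv_le`), `div Ω = 0` (`div curl = 0`), and solve the
similarity vorticity equation (`lerayVorticity_eq`); the Gaussian enstrophy is bounded, so
`gaussianSmall_vorticity_liouville` gives `Ω ≡ 0`, hence `curl V ≡ 0`, hence `V ≡ 0`
(curl-free div-free bounded Liouville) — the discharge is verbatim that of
`typeI_ancient_gaussianGap_eq_zero`. NO decay hypothesis, NO named input. PRINTED CONTEXT (lit
LIT-COVERAGE §35, comparators only — every printed small-Type-I exclusion is EXISTENTIAL, no
number is displayed): [cite: ChaeWolf2017RemovingDSS, Remark 1.4 (arXiv:1610.09464 p. 3)]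
(small space–time constant, DSS, via Gustafson–Kang–Tsai),
[cite: SereginSverak2009, §2 p. 7 (arXiv:0804.1803)] («M(t) > ε/√(−t) for some ε > 0»); the
statement and the Gaussian-enstrophy method below are DERIVED in this cell (typer T31-G), not
quoted from print. [this file; census words on ACCEPT are the lead's (A215); nothing here bears on
NS regularity] -/
theorem typeI_ancient_eq_zero_of_gaussianSmallTypeI {M : ℝ}
    {V : ℝ → EuclideanSpace ℝ (Fin 3) → EuclideanSpace ℝ (Fin 3)} (hV : IsTypeIAncientMild M V)
    (hM : 4 * M ^ 2 + (3 * Real.sqrt 6 / 4) * M < 1) :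
    ∀ t < 0, ∀ x, V t x = 0 := by
  -- notation
  set U : ℝ → EuclideanSpace ℝ (Fin 3) → EuclideanSpace ℝ (Fin 3) := lerayOrbit V with hU_def
  have hΩ_def : ∀ s, lerayVorticity V s = curl (U s) := fun s => rfl
  -- smoothness of the slices
  have hUtop : ∀ s, ContDiff ℝ (⊤ : ℕ∞) (U s) := fun s => contDiff_lerayOrbit_slice_of_typeI hV s le_rfl
  have hU3 : ∀ s, ContDiff ℝ 3 (U s) := fun s => (hUtop s).of_le (by norm_cast)
  have hU1 : ∀ s, ContDiff ℝ 1 (U s) := fun s => (hUtop s).of_le (by norm_cast)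
  have hΩ2 : ∀ s, ContDiff ℝ 2 (lerayVorticity V s) := fun s => by
    rw [hΩ_def]; exact contDiff_curl (hU3 s)
  have hdiv : ∀ s, VectorCalculus.IsDivFree (U s) := fun s =>
    (isDivFree_lerayOrbit_iff V s).2 (hV.isDivFree (neg_neg_of_pos (Real.exp_pos _)))
  have hdivΩ : ∀ s, VectorCalculus.IsDivFree (lerayVorticity V s) := fun s y =>
    divergence_curl_eq_zero_holds _ ((hUtop s).of_le (by norm_cast)) y
  -- the Type-I bound on the profile
  have hM0 : 0 ≤ M := hV.nonneg
  have hUM : ∀ s y, ‖U s y‖ ≤ M := fun s y => norm_lerayOrbit_le_of_typeI hV s y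
  -- class-uniform scale-invariant gauge bounds, k = 1, 2, 3
  obtain ⟨K₁, hK₁⟩ := typeIGauge_exists_pow_mul_norm_iteratedFDeriv_le M 1
  obtain ⟨K₂, hK₂⟩ := typeIGauge_exists_pow_mul_norm_iteratedFDeriv_le M 2
  obtain ⟨K₃, hK₃⟩ := typeIGauge_exists_pow_mul_norm_iteratedFDeriv_le M 3
  have b1 : ∀ s y, ‖fderiv ℝ (U s) y‖ ≤ K₁ := fun s y => by
    rw [← norm_iteratedFDeriv_one]; exact norm_iteratedFDeriv_lerayOrbit_le hV hK₁ s y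
  have b2 : ∀ s y, ‖iteratedFDeriv ℝ 2 (U s) y‖ ≤ K₂ := fun s y => norm_iteratedFDeriv_lerayOrbit_le hV hK₂ s y
  have b3 : ∀ s y, ‖iteratedFDeriv ℝ 3 (U s) y‖ ≤ K₃ := fun s y => norm_iteratedFDeriv_lerayOrbit_le hV hK₃ s y
  have hK₁0 : 0 ≤ K₁ := (norm_nonneg _).trans (b1 0 0)
  have hK₂0 : 0 ≤ K₂ := (norm_nonneg _).trans (b2 0 0)
  have hK₃0 : 0 ≤ K₃ := (norm_nonneg _).trans (b3 0 0)
  -- bounds on the similarity vorticity and its derivatives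
  have c0 : ∀ s y, ‖lerayVorticity V s y‖ ≤ ‖curlCLM‖ * K₁ := fun s y =>
    (norm_curl_le (U s) y).trans (mul_le_mul_of_nonneg_left (b1 s y) (norm_nonneg curlCLM))
  have hDΩ : ∀ s y, fderiv ℝ (lerayVorticity V s) y = curlCLM.comp (fderiv ℝ (fderiv ℝ (U s)) y) := by
    intro s y
    have hd : DifferentiableAt ℝ (fderiv ℝ (U s)) y :=
      (((hU3 s).fderiv_right (m := 2) (by norm_cast)).differentiable (by norm_num)) y
    rw [hΩ_def, curl_eq_curlCLM_comp]
    exact (curlCLM.hasFDerivAt.comp y hd.hasFDerivAt).fderiv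
  have c1 : ∀ s y, ‖fderiv ℝ (lerayVorticity V s) y‖ ≤ ‖curlCLM‖ * K₂ := by
    intro s y
    rw [hDΩ]
    refine (ContinuousLinearMap.opNorm_comp_le _ _).trans (mul_le_mul_of_nonneg_left ?_ (norm_nonneg _))
    rw [← norm_iteratedFDeriv_one, norm_iteratedFDeriv_fderiv]
    exact b2 s y
  have c2 : ∀ s y, ‖iteratedFDeriv ℝ 2 (lerayVorticity V s) y‖ ≤ ‖curlCLM‖ * K₃ := by
    intro s y
    have hf2 : ContDiff ℝ 2 (fderiv ℝ (U s)) := (hU3 s).fderiv_right (m := 2) (by norm_cast)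
    rw [hΩ_def, curl_eq_curlCLM_comp, curlCLM.iteratedFDeriv_comp_left hf2.contDiffAt le_rfl]
    refine (ContinuousLinearMap.norm_compContinuousMultilinearMap_le _ _).trans
      (mul_le_mul_of_nonneg_left ?_ (norm_nonneg _))
    rw [norm_iteratedFDeriv_fderiv]
    exact b3 s y
  -- the global bound feeding the core theorem
  set K₀ : ℝ := M + K₁ + ‖curlCLM‖ * (K₁ + K₂ + K₃) with hK₀
  have hcn : 0 ≤ ‖curlCLM‖ := norm_nonneg curlCLM
  have hbdd : ∀ s₀ : ℝ, ∃ ε > 0, ∃ K : ℝ, ∀ s ∈ Ioo (s₀ - ε) (s₀ + ε), ∀ y,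
      ‖lerayVorticity V s y‖ ≤ K ∧ ‖fderiv ℝ (lerayVorticity V s) y‖ ≤ K ∧
        ‖iteratedFDeriv ℝ 2 (lerayVorticity V s) y‖ ≤ K ∧ ‖U s y‖ ≤ K ∧ ‖fderiv ℝ (U s) y‖ ≤ K := by
    intro s₀
    refine ⟨1, one_pos, K₀, fun s _ y => ⟨?_, ?_, ?_, ?_, ?_⟩⟩
    · exact (c0 s y).trans (by rw [hK₀]; nlinarith)
    · exact (c1 s y).trans (by rw [hK₀]; nlinarith)
    · exact (c2 s y).trans (by rw [hK₀]; nlinarith)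
    · exact (hUM s y).trans (by rw [hK₀]; nlinarith)
    · exact (b1 s y).trans (by rw [hK₀]; nlinarith)
  -- the Gaussian enstrophy is bounded (as in `typeI_ancient_gaussianGap_eq_zero'`)
  have hZ : ∀ s : ℝ, ∫ y, heatKernel 1 y * ‖lerayVorticity V s y‖ ^ 2 ≤ (‖curlCLM‖ * K₁) ^ 2 := by
    intro s
    have hc : Continuous (lerayVorticity V s) := (hΩ2 s).continuous
    have iZ : Integrable fun y => heatKernel 1 y * ‖lerayVorticity V s y‖ ^ 2 :=
      integrable_of_le_poly_heatKernel ((continuous_heatKernel 1).mul (hc.norm.pow 2))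
        (C := (‖curlCLM‖ * K₁) ^ 2) (N := 0) fun y => by
          rw [Real.norm_eq_abs, abs_mul, abs_of_pos (heatKernel_one_pos y),
            abs_of_nonneg (by positivity), pow_zero, mul_one, mul_comm]
          exact mul_le_mul_of_nonneg_right (pow_le_pow_left₀ (norm_nonneg _) (c0 s y) 2)
            (heatKernel_one_pos y).le
    have h1 : ∫ y, heatKernel 1 y * ‖lerayVorticity V s y‖ ^ 2 ≤
        ∫ y, (‖curlCLM‖ * K₁) ^ 2 * heatKernel 1 y :=
      integral_mono iZ ((integrable_heatKernel_holds one_pos).const_mul _) fun y => by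
        have := pow_le_pow_left₀ (norm_nonneg _) (c0 s y) 2
        have hk := (heatKernel_one_pos y).le
        show heatKernel 1 y * ‖lerayVorticity V s y‖ ^ 2 ≤ (‖curlCLM‖ * K₁) ^ 2 * heatKernel 1 y
        nlinarith
    rw [integral_const_mul, integral_heatKernel_eq_one_holds one_pos, mul_one] at h1
    exact h1
  -- the equation as an `s`-derivative (verbatim as in `typeI_ancient_gaussianGap_eq_zero`)
  have hLO := contDiff_uncurry_lerayOrbit_of_typeI hV
  have hG : ContDiff ℝ 1 fun p : ℝ × EuclideanSpace ℝ (Fin 3) => fderiv ℝ (lerayOrbit V p.1) p.2 := by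
    have hf : ContDiff ℝ (⊤ : ℕ∞) (uncurry fun p : ℝ × EuclideanSpace ℝ (Fin 3) => lerayOrbit V p.1) := by
      have e : (uncurry fun p : ℝ × EuclideanSpace ℝ (Fin 3) => lerayOrbit V p.1) =
          uncurry (lerayOrbit V) ∘ fun q : (ℝ × EuclideanSpace ℝ (Fin 3)) × EuclideanSpace ℝ (Fin 3) =>
            (q.1.1, q.2) := by
        funext q; rfl
      rw [e]
      exact hLO.comp ((contDiff_fst.comp contDiff_fst).prodMk contDiff_snd)
    exact hf.fderiv contDiff_snd (by norm_cast)
  have heq : ∀ s y, HasDerivAt (fun σ => lerayVorticity V σ y)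
      ((Δ (lerayVorticity V s)) y - lerayVorticity V s y
        - (1 / 2 : ℝ) • fderiv ℝ (lerayVorticity V s) y y
        - fderiv ℝ (lerayVorticity V s) y (U s y) + fderiv ℝ (U s) y (lerayVorticity V s y)) s := by
    intro s y
    have hGd : Differentiable ℝ fun p : ℝ × EuclideanSpace ℝ (Fin 3) => fderiv ℝ (lerayOrbit V p.1) p.2 :=
      hG.differentiable one_ne_zero
    have h1 : DifferentiableAt ℝ (fun σ : ℝ => fderiv ℝ (lerayOrbit V σ) y) s := by
      have hpair : DifferentiableAt ℝ (fun σ : ℝ => ((σ, y) : ℝ × EuclideanSpace ℝ (Fin 3))) s :=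
        differentiableAt_id.prodMk (differentiableAt_const y)
      exact (hGd (s, y)).comp s hpair
    have e : (fun σ => lerayVorticity V σ y) = fun σ => curlCLM (fderiv ℝ (lerayOrbit V σ) y) := by
      funext σ; rfl
    have hdσ : DifferentiableAt ℝ (fun σ => lerayVorticity V σ y) s := by
      rw [e]
      exact curlCLM.differentiableAt.comp s h1
    have hder := hdσ.hasDerivAt
    have key := hV.lerayVorticity_eq s y
    have htd : timeDerivWithin univ (lerayVorticity V) s y = deriv (fun σ => lerayVorticity V σ y) s := by
      rw [timeDerivWithin_apply, derivWithin_univ]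
    rw [htd] at key
    have hval : deriv (fun σ => lerayVorticity V σ y) s =
        (Δ (lerayVorticity V s)) y - lerayVorticity V s y
          - (1 / 2 : ℝ) • fderiv ℝ (lerayVorticity V s) y y
          - fderiv ℝ (lerayVorticity V s) y (U s y) + fderiv ℝ (U s) y (lerayVorticity V s y) := by
      simp only [convect] at key
      rw [← sub_eq_zero]
      have := sub_eq_zero.mpr key
      rw [← this]
      simp only [hU_def]
      abel
    rw [hval] at hder
    exact hder
  -- the core theorem
  have hΩ0 : ∀ s y, lerayVorticity V s y = 0 :=
    gaussianSmall_vorticity_liouville (Ω := lerayVorticity V) (U := U) hΩ2 hU1 hdiv hdivΩ hbdd heq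
      hM0 hUM hM hZ
  -- back to physical variables: curl-free, divergence-free, bounded slices are constant, hence zero
  have hcurl : ∀ t < 0, ∀ x, curl (V t) x = 0 := by
    intro t ht x
    set s : ℝ := -Real.log (-t) with hs
    have hts : -Real.exp (-s) = t := by
      rw [hs, neg_neg, Real.exp_log (neg_pos.2 ht), neg_neg]
    have h := hΩ0 s ((Real.exp (-s / 2))⁻¹ • x)
    rw [lerayVorticity_apply, curl_lerayOrbit, smul_smul,
      mul_inv_cancel₀ (Real.exp_pos _).ne', one_smul, hts, smul_eq_zero] at h
    exact h.resolve_left (Real.exp_pos _).ne'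
  have hconst : ∀ t < 0, ∀ x, V t x = V t 0 := fun t ht x =>
    eq_of_curl_eq_zero_of_isDivFree_of_bounded ((hV.contDiff_slice ht).of_le (by norm_cast))
      (hcurl t ht) (hV.isDivFree ht) (fun z => hV.norm_le ht z) x 0
  exact fun t ht x => hV.eq_zero_of_slice_const (b := fun t => V t 0) hconst ht x

/-- **T31-G at CLASS level: the explicit, unconditional small-Type-I exclusion** — the conclusion
shape of `ExplicitThreshold.rdssClass_empty_of_timeOnlyThreshold` with NO hypothesis `h`. For every
Type-I constant `M` with `4M² + (3√6/4)·M < 1` (`M < m₀ ≈ 0.3206`) the hypothesis class of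
`RdssProfileTruncation` — any factor `c > 1`, ANY twist `R ∈ O(3)` — is EMPTY: the smooth KNSS-gauge
Type-I representative (`typeI_ancient_smoothRepresentative_ae`, constant `M`) vanishes by
`typeI_ancient_eq_zero_of_gaussianSmallTypeI`, so every slice of `u` is a.e. zero. MECHANISM
DSS-BLIND: the proof discards `c`, `R`, `IsRotatedDSS`; the statement holds verbatim for every
Type-I-decay ancient mild solution with such `M`. UNCONDITIONAL: no (D), no (D_M). [this file;
typer T31-G; census words on ACCEPT are the lead's (A215); nothing numerical is asserted and
nothing here bears on NS regularity] -/
theorem rdssClass_empty_of_gaussianSmallTypeI {M : ℝ}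
    (hM : 4 * M ^ 2 + (3 * Real.sqrt 6 / 4) * M < 1) :
    ¬ ∃ (c : ℝ) (R : (EuclideanSpace ℝ (Fin 3)) ≃ₗᵢ[ℝ] (EuclideanSpace ℝ (Fin 3)))
        (u : ℝ → (EuclideanSpace ℝ (Fin 3)) → (EuclideanSpace ℝ (Fin 3))),
      1 < c ∧ IsAncientMildSolution 1 u ∧ (∀ t < 0, AEStronglyMeasurable (u t) volume) ∧
      IsRotatedDSS c R u ∧ HasTypeIDecay M u ∧ ¬ (∀ t < 0, u t =ᵐ[volume] 0) := by
  rintro ⟨c, R, u, -, hmild, hmeas, -, hdec, hne⟩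
  obtain ⟨V, hT, -, hVu, -⟩ := typeI_ancient_smoothRepresentative_ae hmild hmeas hdec
  have hz : ∀ t < 0, ∀ x, V t x = 0 := typeI_ancient_eq_zero_of_gaussianSmallTypeI hT hM
  refine hne fun t ht => ?_
  have hVz : V t = 0 := funext fun x => by simpa using hz t ht x
  exact (hVu t ht).symm.trans (Filter.EventuallyEq.of_eq hVz)

/-- **A rational sufficient condition:** `0 ≤ M ≤ 8/25 = 0.32` implies `4M² + (3√6/4)M < 1`
(`√6 < 49/20`, `4·(8/25)² + (3/4)(49/20)(8/25) = 0.9976 < 1`). [this file] -/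
theorem gaussianSmall_condition_of_le {M : ℝ} (hM0 : 0 ≤ M) (hM : M ≤ 8 / 25) :
    4 * M ^ 2 + (3 * Real.sqrt 6 / 4) * M < 1 := by
  have hs : Real.sqrt 6 < 49 / 20 := (Real.sqrt_lt' (by norm_num)).2 (by norm_num)
  have h1 : M ^ 2 ≤ 8 / 25 * M := by nlinarith
  have h2 : Real.sqrt 6 * M ≤ 49 / 20 * M := mul_le_mul_of_nonneg_right hs.le hM0
  nlinarith

/-- **T31-G, CLASSICAL level, rational form:** a KNSS-gauge Type-I ancient mild field with Type-I
constant `M ≤ 8/25 = 0.32` vanishes (`typeI_ancient_eq_zero_of_gaussianSmallTypeI` +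
`gaussianSmall_condition_of_le`; `0 ≤ M` is automatic, `IsTypeIAncientMild.nonneg`). UNCONDITIONAL.
[this file; typer T31-G; nothing here bears on NS regularity] -/
theorem typeI_ancient_eq_zero_of_typeI_le {M : ℝ}
    {V : ℝ → EuclideanSpace ℝ (Fin 3) → EuclideanSpace ℝ (Fin 3)} (hV : IsTypeIAncientMild M V)
    (hM : M ≤ 8 / 25) : ∀ t < 0, ∀ x, V t x = 0 :=
  typeI_ancient_eq_zero_of_gaussianSmallTypeI hV (gaussianSmall_condition_of_le hV.nonneg hM)

/-- **T31-G at CLASS level, rational form:** for every Type-I constant `M ≤ 8/25 = 0.32` the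
hypothesis class of `RdssProfileTruncation` (any `c > 1`, any twist `R ∈ O(3)`) is EMPTY —
UNCONDITIONAL, DSS-blind (`rdssClass_empty_of_gaussianSmallTypeI` + `gaussianSmall_condition_of_le`;
for `M < 0` the hypothesis `HasTypeIDecay M u` is unsatisfiable — `0 ≤ ‖u‖ ≤ M/(‖x‖ + √(−t))` forces
`0 ≤ M` — so the statement is vacuously true there; inside, `0 ≤ M` comes from the smooth
representative's `IsTypeIAncientMild M V`, red R-91).
[this file; typer T31-G; census words on ACCEPT are the lead's; nothing here bears on NS regularity] -/
theorem rdssClass_empty_of_typeI_le {M : ℝ} (hM : M ≤ 8 / 25) :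
    ¬ ∃ (c : ℝ) (R : (EuclideanSpace ℝ (Fin 3)) ≃ₗᵢ[ℝ] (EuclideanSpace ℝ (Fin 3)))
        (u : ℝ → (EuclideanSpace ℝ (Fin 3)) → (EuclideanSpace ℝ (Fin 3))),
      1 < c ∧ IsAncientMildSolution 1 u ∧ (∀ t < 0, AEStronglyMeasurable (u t) volume) ∧
      IsRotatedDSS c R u ∧ HasTypeIDecay M u ∧ ¬ (∀ t < 0, u t =ᵐ[volume] 0) := by
  rintro ⟨c, R, u, -, hmild, hmeas, -, hdec, hne⟩
  obtain ⟨V, hT, -, hVu, -⟩ := typeI_ancient_smoothRepresentative_ae hmild hmeas hdec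
  have hz : ∀ t < 0, ∀ x, V t x = 0 := typeI_ancient_eq_zero_of_typeI_le hT hM
  refine hne fun t ht => ?_
  have hVz : V t = 0 := funext fun x => by simpa using hz t ht x
  exact (hVu t ht).symm.trans (Filter.EventuallyEq.of_eq hVz)

end Summit.NavierStokesRegularity.NavierStokesRegularity.Theorems.GaussianGap
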